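import Literature.AnabelianGeometry.EtaleTheta.Discharge.Sec1CuspInertiaTateTwist
import Literature.AnabelianGeometry.EtaleTheta.SettingBridgeCuspLaws
import Literature.AnabelianGeometry.EtaleTheta.SettingModelCyclotomicCharacterLevelNontrivial
import HarnessLib

/-!
# [EtTh] §1: NO CENTRALISED CUSP AT A JOINT ORIGIN — at `IsTateOrigin` + R2 + the cusp law C3 the decomposition
# group of a cusp cannot centralise its inertia (so it is non-abelian): the interface form of «`I_x ≅ Ẑ(1)`»

Mochizuki, *The étale theta function and its Frobenioid-theoretic manifestations*, Publ. RIMS **45** (2009) [EtTh],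
§1, kurims PDF p. 13 «`(Δ^tp_Y)^ell ≅ Ẑ(1)`», «`G_{K_N}` acts trivially on `(Δ^tp_X)^ell/N·(Δ^tp_Y)^ell`», Def. 2.1
p. 35 «a natural injective [outer] homomorphism `D_x → Π^Θ_X` … which maps the inertia group `I_x ⊆ D_x` isomorphically
onto `Δ_Θ`. Thus, we have exact sequences … `1 → Δ_Θ → D̄_x → G_K → 1`» [cite: MochizukiEtTh2009, Def 2.1 p.35];
[SemiAnbd] §6 p. 71 «`D_x` always surjects onto an open subgroup of `G_K`», «`I_x` is isomorphic to `Ẑ(1)` if `x` is a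
cusp» [cite: MochizukiSemiAnbd2006, §6 p.71]; J. Neukirch, *Algebraic Number Theory* (1999), Ch. II Prop. (5.7) (i)
(roots of unity in local fields) [cite: NeukirchANT1999, Ch. II Prop. (5.7) (i)].  abc-iut cell, layer L2, seat
abc-iut-w5-d051 (gen 4; NV / §1-interface lane); PROOF-ONLY sequel of `Sec1CuspInertiaTateTwist.lean` (p452622).

WHAT.  A `D : ThetaSetting p` carrying the guard `IsEtThOrigin`, the closedness binder `hYcl` (G-w4d021-2), the
Tate-module clause `IsTateOrigin`, the printed construction of `Y_N` (R2, `Thm16Sub.GtpYNFromCusp`, every `N`), and a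
cusp `x` with `D_x ⊆ Π^tp_Y` (parameter (P3) of abc-iut-L2-t7's `OncePuncturedData`) satisfying the cusp law C3
«`toTheta(I_x) = Δ_Θ`» (abc-iut-L2-t7's `ThetaSetting.CuspLaws.map_toTheta_inertia`):

* **`ThetaSetting.IsTateOrigin.not_centralises_inertia_of_cuspLaw`** — `D_x` does NOT centralise `I_x`:
  `¬ ∀ d ∈ D_x, ∀ w ∈ I_x, d w d⁻¹ = w`.  Proof: C3 gives `w ∈ I_x` with `θ(w) = θ[z, y₁]`, the generator of `Δ_Θ`
  modulo `N` of the Tate-module clause; the image `aug(D_x)` is OPEN (root field `isOpen_aug_decomp`), so it contains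
  `σ = aug(d)` with `χ_n(σ) ≠ 1` at some level `n` (abc-iut-w5-d091/L2-t5's `exists_mem_levelChar_chi_ne_one_of_isOpen`
  — Neukirch II (5.7): no open subgroup of `G_{ℚ_p}` fixes all roots of unity); if `d` centralised `w`, p452622's
  centraliser law `IsTateOrigin.pow_eq_pow_mul_of_centralises` would give `θ(w) = e^n θ(w)^k` for `σ ζ_n = ζ_n^k`, i.e.
  `θ[z,y₁]^{k-1} ∈ Δ_Θ^n`, whence `n ∣ k − 1` by the exact order of `θ[z,y₁]` modulo `n` (abc-iut-w5-d187's
  `dvd_of_commutator_pow_eq_pow`, clause (a)), so `σ ζ_n = ζ_n` and `χ_n(σ) = 1` — contradiction;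
* `ThetaSetting.IsTateOrigin.decomp_not_commutative_of_cuspLaw` — hence `D_x` is NON-ABELIAN;
* the joint-origin forms `not_centralises_inertia_of_origins` / `decomp_not_commutative_of_origins` (`IsThm16Origin`
  supplies R2; abc-iut-L2-t7's bundle `CuspLaws` supplies C3; `OncePuncturedData` supplies (P3)).

WHY (NV census of the origin predicates).  This is the STRUCTURAL form of `SettingModel.modelκ'_not_isTateOrigin`
(p443517) for every PRODUCT-TYPE cusp datum at once: an untwisted carrier whose cusp decomposition group is
`I_x × G` (abc-iut-L2-t10's `modelκ′`, abc-iut-w5-d165's `model₂ᶜ`: the inertia is CENTRAL in `D_x`, and R2 + C3 hold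
there) can never carry `IsTateOrigin`; together with abc-iut-w5-d165's power-twist obstruction
(`SettingModelChiTwistCuspObstruction`: a twisted carrier moves the cusp-inertia class) it brackets the residual joint
inhabitant of `IsThm16Origin ∧ IsTateOrigin ∧ CuspLaws` from both sides — its cusp decomposition group must be a
genuinely non-abelian extension `1 → Ẑ(1) → D_x → G_K → 1`, as print says.  Companion, in the [GalSect] vocabulary:
abc-iut-w5-d029's `not_isCyclotomic_of_conj_eq` (C7e).  PROOF-ONLY: no definition, no instance, no named fact; nothing
restated.  HONEST FRAMING: interface law over the frozen root; the origin predicates, `hYcl` and C3 are hypotheses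
inhabited only at models; nothing of [EtTh]/[SemiAnbd] is asserted for genuine tempered fundamental groups; no side is
taken on [IUTchIII] Cor. 3.12; typed ≠ proved.
-/

noncomputable section

namespace Literature.AnabelianGeometry.EtaleTheta

open Literature.AnabelianGeometry.SemiGraphs Thm16Sub
open scoped Pointwise

namespace ThetaSetting

variable {p : ℕ} [Fact p.Prime] {D : ThetaSetting p}

/-- The image of a decomposition group under `aug` is OPEN, as a subgroup of `G_{ℚ_p}` (root field
`isOpen_aug_decomp`: «`D_x` always surjects onto an open subgroup of `G_K`»). [cite: MochizukiSemiAnbd2006, §6 p.71] -/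
theorem isOpen_map_aug_decomp (x : D.Pt) :
    IsOpen (((D.decomp x).map D.aug.toMonoidHom : Subgroup (GQp p)) : Set (GQp p)) := by
  rw [Subgroup.coe_map]
  exact D.isOpen_aug_decomp x

/-- **NO CENTRALISED CUSP AT `IsTateOrigin` + R2 + C3.**  At `IsEtThOrigin` + `hYcl` + `IsTateOrigin` + R2 (every `N`),
for a cusp `x` with `D_x ⊆ Π^tp_Y` whose inertia maps ONTO `Δ_Θ` in the theta quotient (cusp law C3), the
decomposition group `D_x` does not centralise the inertia `I_x` — the cusp inertia is a `Ẑ(1)`, NOT a `Ẑ` with trivial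
action, for its own decomposition group. [cite: MochizukiEtTh2009, Def 2.1 p.35] -/
theorem IsTateOrigin.not_centralises_inertia_of_cuspLaw (hO : D.IsEtThOrigin)
    (hYcl : (D.DtpY.map D.toHat.toMonoidHom).topologicalClosure ≤
      D.DtpY.map D.toHat.toMonoidHom ⊔ (⁅⁅D.DeltaHat, D.DeltaHat⁆, D.DeltaHat⁆).topologicalClosure)
    (hT : D.IsTateOrigin) (hR2 : ∀ N : ℕ+, GtpYNFromCusp D N) {x : D.Pt} (hx : D.IsCusp x)
    (hP3 : D.decomp x ≤ D.GtpY) (hC3 : (D.inertia x).map D.toTheta = D.DeltaTheta) :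
    ¬ ∀ d ∈ D.decomp x, ∀ w ∈ D.inertia x, d * w * d⁻¹ = w := by
  intro hcent
  -- an element of the open image `aug(D_x)` moving some root of unity
  obtain ⟨σ, hσU, n, hn⟩ :=
    SettingModel.exists_mem_levelChar_chi_ne_one_of_isOpen p _ (D.isOpen_map_aug_decomp x)
  obtain ⟨d, hd, rfl⟩ := hσU
  -- the Tate-module clause at level `n`: generator `θ[z, y₁]` of `Δ_Θ` modulo `n`
  obtain ⟨y₁, z, ζ, -, hy₁, hz, hzZ, hζ, -, -, hord, -, -⟩ := hT.tate n
  -- C3: the generator lies in `θ(I_x)`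
  have hc₀ : D.toTheta (z * y₁ * z⁻¹ * y₁⁻¹) ∈ (D.inertia x).map D.toTheta := by
    rw [hC3]
    exact D.toTheta_commutator_mem_deltaTheta hz hy₁.2
  obtain ⟨w, hw, hwc⟩ := hc₀
  -- the character value of `aug d` on `ζ`
  obtain ⟨k, hk⟩ := exists_apply_eq_pow hζ (D.aug.toMonoidHom d)
  -- the centraliser law of p452622
  have hDc : D.IsCuspidalDecompositionGroup (D.decomp x) := ⟨x, hx, 1, (one_smul _ _).symm⟩
  obtain ⟨e, he, hE⟩ := hT.pow_eq_pow_mul_of_centralises hO hYcl hR2 hDc hP3 n hζ hk hw (hcent d hd w hw)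
  rw [hwc] at hE
  -- `aug d` fixes `ζ`
  have hfix : D.aug.toMonoidHom d ζ = ζ := by
    rcases k with _ | k'
    · -- `aug d ζ = ζ^0 = 1` forces `ζ = 1`
      have h1 : ζ = 1 := (D.aug.toMonoidHom d).injective (by rw [hk, pow_zero, map_one])
      rw [h1, map_one]
    · -- `c₀ = e^n c₀^(k'+1)` ⇒ `c₀^k' = (e⁻¹)^n` ⇒ `n ∣ k'`
      rw [pow_succ, ← mul_assoc] at hE
      have h2 : e ^ (n : ℕ) * D.toTheta (z * y₁ * z⁻¹ * y₁⁻¹) ^ k' = 1 := by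
        have h3 := congrArg (fun t => t * (D.toTheta (z * y₁ * z⁻¹ * y₁⁻¹))⁻¹) hE
        simp only [mul_inv_cancel, mul_inv_cancel_right] at h3
        exact h3.symm
      have h1 : D.toTheta (z * y₁ * z⁻¹ * y₁⁻¹) ^ k' = e⁻¹ ^ (n : ℕ) := by
        rw [inv_pow]
        exact eq_inv_of_mul_eq_one_right h2
      have hdvd : (n : ℕ) ∣ k' := D.dvd_of_commutator_pow_eq_pow hO hYcl hz hzZ hy₁ hord (inv_mem he) h1
      rw [hk, pow_succ, (hζ.pow_eq_one_iff_dvd k').mpr hdvd, one_mul]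
  exact hn (SettingModel.levelChar_chi_eq_one_of_apply_eq p _ n hζ hfix)

/-- **Hence the decomposition group of such a cusp is NON-ABELIAN** (`1 → Ẑ(1) → D̄_x → G_K → 1` is a genuinely
non-commutative extension). [cite: MochizukiEtTh2009, Def 2.1 p.35] -/
theorem IsTateOrigin.decomp_not_commutative_of_cuspLaw (hO : D.IsEtThOrigin)
    (hYcl : (D.DtpY.map D.toHat.toMonoidHom).topologicalClosure ≤
      D.DtpY.map D.toHat.toMonoidHom ⊔ (⁅⁅D.DeltaHat, D.DeltaHat⁆, D.DeltaHat⁆).topologicalClosure)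
    (hT : D.IsTateOrigin) (hR2 : ∀ N : ℕ+, GtpYNFromCusp D N) {x : D.Pt} (hx : D.IsCusp x)
    (hP3 : D.decomp x ≤ D.GtpY) (hC3 : (D.inertia x).map D.toTheta = D.DeltaTheta) :
    ¬ ∀ a ∈ D.decomp x, ∀ b ∈ D.decomp x, a * b = b * a := by
  intro hcomm
  refine hT.not_centralises_inertia_of_cuspLaw hO hYcl hR2 hx hP3 hC3 fun d hd w hw => ?_
  rw [hcomm d hd w hw.1, mul_inv_cancel_right]

/-! ### Joint-origin forms (`IsThm16Origin ∧ IsTateOrigin` with the cusp-law bundle `CuspLaws`) -/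

/-- **At a JOINT origin carrying abc-iut-L2-t7's `CuspLaws`, no cusp with `D_x ⊆ Π^tp_Y` has its inertia centralised by
its decomposition group** (R2 from `IsThm16Origin`, C3 from `CuspLaws.map_toTheta_inertia`).
[cite: MochizukiEtTh2009, Def 2.1 p.35] -/
theorem not_centralises_inertia_of_origins (hO : D.IsEtThOrigin)
    (hYcl : (D.DtpY.map D.toHat.toMonoidHom).topologicalClosure ≤
      D.DtpY.map D.toHat.toMonoidHom ⊔ (⁅⁅D.DeltaHat, D.DeltaHat⁆, D.DeltaHat⁆).topologicalClosure)
    (h16 : D.IsThm16Origin) (hT : D.IsTateOrigin) (hL : D.CuspLaws) {x : D.Pt} (hx : D.IsCusp x)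
    (hP3 : D.decomp x ≤ D.GtpY) :
    ¬ ∀ d ∈ D.decomp x, ∀ w ∈ D.inertia x, d * w * d⁻¹ = w :=
  hT.not_centralises_inertia_of_cuspLaw hO hYcl h16.gtpYN_fromCusp hx hP3 (hL.map_toTheta_inertia x hx)

/-- **… in particular `D_x` is non-abelian.** [cite: MochizukiEtTh2009, Def 2.1 p.35] -/
theorem decomp_not_commutative_of_origins (hO : D.IsEtThOrigin)
    (hYcl : (D.DtpY.map D.toHat.toMonoidHom).topologicalClosure ≤
      D.DtpY.map D.toHat.toMonoidHom ⊔ (⁅⁅D.DeltaHat, D.DeltaHat⁆, D.DeltaHat⁆).topologicalClosure)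
    (h16 : D.IsThm16Origin) (hT : D.IsTateOrigin) (hL : D.CuspLaws) {x : D.Pt} (hx : D.IsCusp x)
    (hP3 : D.decomp x ≤ D.GtpY) :
    ¬ ∀ a ∈ D.decomp x, ∀ b ∈ D.decomp x, a * b = b * a :=
  hT.decomp_not_commutative_of_cuspLaw hO hYcl h16.gtpYN_fromCusp hx hP3 (hL.map_toTheta_inertia x hx)

/-- **With the parameter bundle `OncePuncturedData`** ((P3) «decomposition groups of cusps lie in `Π^tp_Y`» by name):
at a joint origin with `CuspLaws`, the decomposition group of EVERY cusp fails to centralise its inertia.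
[cite: MochizukiEtTh2009, Def 2.1 p.35] -/
theorem not_centralises_inertia_of_origins_of_oncePuncturedData (hO : D.IsEtThOrigin)
    (hYcl : (D.DtpY.map D.toHat.toMonoidHom).topologicalClosure ≤
      D.DtpY.map D.toHat.toMonoidHom ⊔ (⁅⁅D.DeltaHat, D.DeltaHat⁆, D.DeltaHat⁆).topologicalClosure)
    (h16 : D.IsThm16Origin) (hT : D.IsTateOrigin) (hL : D.CuspLaws) (P : D.OncePuncturedData) {x : D.Pt}
    (hx : D.IsCusp x) :
    ¬ ∀ d ∈ D.decomp x, ∀ w ∈ D.inertia x, d * w * d⁻¹ = w :=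
  D.not_centralises_inertia_of_origins hO hYcl h16 hT hL hx (P.decomp_le_ker_toZ x hx)

/-- **… and is non-abelian, for every cusp.** [cite: MochizukiEtTh2009, Def 2.1 p.35] -/
theorem decomp_not_commutative_of_origins_of_oncePuncturedData (hO : D.IsEtThOrigin)
    (hYcl : (D.DtpY.map D.toHat.toMonoidHom).topologicalClosure ≤
      D.DtpY.map D.toHat.toMonoidHom ⊔ (⁅⁅D.DeltaHat, D.DeltaHat⁆, D.DeltaHat⁆).topologicalClosure)
    (h16 : D.IsThm16Origin) (hT : D.IsTateOrigin) (hL : D.CuspLaws) (P : D.OncePuncturedData) {x : D.Pt}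
    (hx : D.IsCusp x) :
    ¬ ∀ a ∈ D.decomp x, ∀ b ∈ D.decomp x, a * b = b * a :=
  D.decomp_not_commutative_of_origins hO hYcl h16 hT hL hx (P.decomp_le_ker_toZ x hx)

end ThetaSetting

end Literature.AnabelianGeometry.EtaleTheta

end
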